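import Summits.CriticalPhenomena.PercolationContinuityZ3.Theorems.PercNearOneGluingNoHeavyLowerTailCILScaledReferenceTools
import Summits.CriticalPhenomena.PercolationContinuityZ3.Theorems.PercNearOneGluingNoHeavyLowerTailCILAveragedPortTools
import HarnessLib

/-!
# `NoHeavyLowerTail` (stmt-CriticalPhenomena-4575) — the PORT STEP of the two-sided kernel: the E-mass of a port is
# controlled one star edge down

Support file (prover `prim-hp-3`, hull-port line, submodularity / Rayleigh-monotonicity seat; `--supports stmt-CriticalPhenomena-4575`).
No definitions, no named facts, no sorries.

Notation: `μ_w = prodBernoulli w` on `Fin n`, relays `A`, level `j`, `π(v) = {z ∈ A : v ↔ z}`, lightness `I_w(v) = μ_w{|π(v)| ≤ j}`;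
`O` a finite set of observers, `π(O) = {z ∈ A : ∃ x ∈ O, x ↔ z}`.  For a vertex `c` the E-MASS of `c` is
  `E_w(c) := μ_w(c ↮ O, 1 ≤ |π(O)| ≤ j) + μ_w(c ↔ O, |π(c)| ≤ j)`
(two disjoint events; written below as this sum).  In the two-pendant-stars kernel of the crux (memos
`run/shared/lean/prim/prim-hp-3/HULLPORT-REF-gen3.md`, `…-gen5.md`), with `O = {o₁,o₂}` and `H` the graph with both stars,
`E_H(q) = bad_G(o) + (I_H(q) − I_G(q))` (`G = H/(o₁ ~ o₂)`), and the kernel statements are bounds on `E_H(q)`: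
TPS-domination ⟺ `E_H(q) ≤ I_H(q)` for `q` dominating the ports, hp-2's (DC) ⟺ `E_H(q) ≤ max_t I_H(t)`, PORT-QOSL ⟺
`E_H(q) ≤ max(I_H(q), max_t I_H(t))`.

**Theorem (`HullPort.obsE_le_max_of_erase`, the port step).**  Let `o ∈ O`, `p ≠ o`, `q ≠ p`, `e = s(p,o)`, `w₀ = w[e ↦ 0]`.
If `E_{w₀}(p) ≤ I_{w₀}(q)` then `E_w(p) ≤ max(I_w(p), I_w(q))`.

Proof.  Every `μ_w`-probability is affine in `w e` (`HullPort.real_update_affine`):  `E_w(p) = (1 − w e)·E_{w₀}(p) + (w e)·E_{w₁}(p)`,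
`w₁ = w[e ↦ 1]`.  Under `w₁` the pair `e` is a.s. open, so `p ↔ o ∈ O` a.s.: the first event of `E_{w₁}(p)` is null and the second is
contained in `{|π(p)| ≤ j}`, whence `E_{w₁}(p) ≤ I_{w₁}(p)` (`obsE_weight_one_le`).  If `I_{w₀}(q) ≤ I_{w₀}(p)` the two endpoint bounds
combine to `I_w(p)`.  Otherwise `I_{w₀}(p) < I_{w₀}(q)`, and raising the pair `e` — a pair AT `p`, not containing `q` — keeps
`I(p) ≤ I(q)` (`HullPort.lightness_le_of_raise_own_edge`, Rayleigh-type monotonicity from van den Berg–Häggström–Kahn Thm 1.5), so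
`E_{w₁}(p) ≤ I_{w₁}(p) ≤ I_{w₁}(q)` and the endpoint bounds combine to `I_w(q)`.

WHY (crux notes HULLPORT-REF-gen5.md §3): with `O = {o₁,o₂}` the two pendant stars, `p` a port of `o = o_s` and `q` the lightest port
of `H − e`, this says that (DC) for the PORT `p` of `H` follows from (DC) for the vertex `p` in `H − e` (one star edge fewer; `p` may be
an outsider there).  By induction on the number of star edges the whole two-sided kernel ((DC), hence PORT-QOSL and TPS-domination
for all shapes and levels) is therefore equivalent to the OUTSIDER STEP "(DC) below + (DC) for the ports of `H` ⇒ (DC) for relays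
outside the ports"; the natural closing of that step ("the E-champion is a port", `E(i) ≤ max_p E(p)`) is FALSE (exact `k = 9`
witness, memo §4).  With `O = {o}` a single relay-ported observer (`E(p) = bad(o)` for every relay `p`) the same three lines give
one-group CIL in the form `bad(o) ≤ max_t I(t)` — the averaging-free core of `AveragedPort.bad_le_firstOpenSum`.
`HullPort.obsE_le_max_sup_of_erase` packages the step with a finite comparison set `Q` (the remaining ports).
-/

noncomputable section

namespace Summit.CriticalPhenomena.PercolationContinuityZ3.Theorems

open MeasureTheory Set Literature.Probability.LatticeModels Literature.Probability.Percolation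
open scoped Classical BigOperators

variable {n : ℕ}

namespace HullPort

/-- **Weight-one endpoint.**  If the pair `s(p,o)` is sure (`w s(p,o) = 1`) and `o ∈ O`, then
`μ_w(p ↮ O, 1 ≤ |π(O)| ≤ j) + μ_w(p ↔ O, |π(p)| ≤ j) ≤ I_w(p)`: the first event is null (a.s. `p ↔ o`), the second lies in `{|π(p)| ≤ j}`.
[folklore] -/
theorem obsE_weight_one_le (w : Sym2 (Fin n) → unitInterval) (A O : Finset (Fin n)) (o p : Fin n) (j : ℕ)
    (ho : o ∈ O) (hpo : p ≠ o) (hw : w s(p, o) = 1) :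
    (prodBernoulli w).real {ω : BondConfig (Fin n) | (∀ x ∈ O, ω ∉ openConn p x) ∧
        1 ≤ (A.filter fun z => ∃ x ∈ O, ω ∈ openConn x z).card ∧
        (A.filter fun z => ∃ x ∈ O, ω ∈ openConn x z).card ≤ j} +
      (prodBernoulli w).real {ω : BondConfig (Fin n) | (∃ x ∈ O, ω ∈ openConn p x) ∧
        (A.filter fun z => ω ∈ openConn p z).card ≤ j} ≤
      (prodBernoulli w).real {ω : BondConfig (Fin n) | (A.filter fun z => ω ∈ openConn p z).card ≤ j} := by
  have hnull : (prodBernoulli w).real {ω : BondConfig (Fin n) | (∀ x ∈ O, ω ∉ openConn p x) ∧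
        1 ≤ (A.filter fun z => ∃ x ∈ O, ω ∈ openConn x z).card ∧
        (A.filter fun z => ∃ x ∈ O, ω ∈ openConn x z).card ≤ j} =
      (prodBernoulli w).real (∅ : Set (BondConfig (Fin n))) := by
    apply edgeSw_real_eq_of_sure w s(p, o) hw
    intro ω he
    simp only [mem_setOf_eq, mem_empty_iff_false, iff_false, not_and]
    intro hsep
    exfalso
    have hadj : (openGraph ω).Adj p o := (openGraph_adj ω p o).mpr ⟨he, hpo⟩
    exact hsep o ho (hadj.reachable : (openGraph ω).Reachable p o)
  rw [hnull, measureReal_empty, zero_add]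
  exact measureReal_mono (fun ω hω => hω.2)

/-- **The port step.**  Let `o ∈ O`, `p ≠ o`, `q ≠ p`, `e = s(p,o)`.  If, with the pair `e` deleted,
`μ(p ↮ O, 1 ≤ |π(O)| ≤ j) + μ(p ↔ O, |π(p)| ≤ j) ≤ I(q)`, then under `w` itself
`μ_w(p ↮ O, 1 ≤ |π(O)| ≤ j) + μ_w(p ↔ O, |π(p)| ≤ j) ≤ max(I_w(p), I_w(q))`.
(Affinity in `w e`; the weight-one endpoint is `≤ I(p)`; if `p` is the lighter of `p, q` without `e`, raising the own pair `e` of `p`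
keeps it lighter.) [cite: VandenbergHaggstromKahn2005, Thm. 1.5 (p. 7) — via `HullPort.lightness_le_of_raise_own_edge`; this work] -/
theorem obsE_le_max_of_erase (w : Sym2 (Fin n) → unitInterval) (A O : Finset (Fin n)) (o p q : Fin n) (j : ℕ)
    (ho : o ∈ O) (hpo : p ≠ o) (hqp : q ≠ p)
    (h0 : (prodBernoulli (Function.update w s(p, o) 0)).real {ω : BondConfig (Fin n) | (∀ x ∈ O, ω ∉ openConn p x) ∧
          1 ≤ (A.filter fun z => ∃ x ∈ O, ω ∈ openConn x z).card ∧
          (A.filter fun z => ∃ x ∈ O, ω ∈ openConn x z).card ≤ j} +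
        (prodBernoulli (Function.update w s(p, o) 0)).real {ω : BondConfig (Fin n) | (∃ x ∈ O, ω ∈ openConn p x) ∧
          (A.filter fun z => ω ∈ openConn p z).card ≤ j} ≤
        (prodBernoulli (Function.update w s(p, o) 0)).real
          {ω : BondConfig (Fin n) | (A.filter fun z => ω ∈ openConn q z).card ≤ j}) :
    (prodBernoulli w).real {ω : BondConfig (Fin n) | (∀ x ∈ O, ω ∉ openConn p x) ∧
        1 ≤ (A.filter fun z => ∃ x ∈ O, ω ∈ openConn x z).card ∧
        (A.filter fun z => ∃ x ∈ O, ω ∈ openConn x z).card ≤ j} +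
      (prodBernoulli w).real {ω : BondConfig (Fin n) | (∃ x ∈ O, ω ∈ openConn p x) ∧
        (A.filter fun z => ω ∈ openConn p z).card ≤ j} ≤
      max ((prodBernoulli w).real {ω : BondConfig (Fin n) | (A.filter fun z => ω ∈ openConn p z).card ≤ j})
        ((prodBernoulli w).real {ω : BondConfig (Fin n) | (A.filter fun z => ω ∈ openConn q z).card ≤ j}) := by
  set e : Sym2 (Fin n) := s(p, o) with he
  set Sb : Set (BondConfig (Fin n)) := {ω | (∀ x ∈ O, ω ∉ openConn p x) ∧
        1 ≤ (A.filter fun z => ∃ x ∈ O, ω ∈ openConn x z).card ∧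
        (A.filter fun z => ∃ x ∈ O, ω ∈ openConn x z).card ≤ j} with hSb
  set Sa : Set (BondConfig (Fin n)) := {ω | (∃ x ∈ O, ω ∈ openConn p x) ∧
        (A.filter fun z => ω ∈ openConn p z).card ≤ j} with hSa
  set Rp : Set (BondConfig (Fin n)) := {ω | (A.filter fun z => ω ∈ openConn p z).card ≤ j} with hRp
  set Rq : Set (BondConfig (Fin n)) := {ω | (A.filter fun z => ω ∈ openConn q z).card ≤ j} with hRq
  set w₀ := Function.update w e 0 with hw₀
  set w₁ := Function.update w e 1 with hw₁
  set t : ℝ := (w e : ℝ) with ht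
  have ht0 : 0 ≤ t := (w e).2.1
  have ht1 : t ≤ 1 := (w e).2.2
  have hwe : Function.update w e (w e) = w := Function.update_eq_self e w
  -- affinity in the coordinate `e` for the four events
  have aff : ∀ S : Set (BondConfig (Fin n)),
      (prodBernoulli w).real S = (1 - t) * (prodBernoulli w₀).real S + t * (prodBernoulli w₁).real S := by
    intro S
    have h := real_update_affine w e (w e) S
    rw [hwe] at h
    exact h
  -- the weight-one endpoint
  have hw₁e : w₁ s(p, o) = 1 := by simp [hw₁, he]
  have h1 : (prodBernoulli w₁).real Sb + (prodBernoulli w₁).real Sa ≤ (prodBernoulli w₁).real Rp :=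
    obsE_weight_one_le w₁ A O o p j ho hpo hw₁e
  rw [aff Sb, aff Sa]
  by_cases hc : (prodBernoulli w₀).real Rq ≤ (prodBernoulli w₀).real Rp
  · -- `p` is no heavier than `q` without `e`: bound by `I_w(p)`
    refine le_trans ?_ (le_max_left _ _)
    rw [aff Rp]
    have hA : (1 - t) * ((prodBernoulli w₀).real Sb + (prodBernoulli w₀).real Sa) ≤
        (1 - t) * (prodBernoulli w₀).real Rp :=
      mul_le_mul_of_nonneg_left (h0.trans hc) (by linarith)
    have hB : t * ((prodBernoulli w₁).real Sb + (prodBernoulli w₁).real Sa) ≤ t * (prodBernoulli w₁).real Rp :=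
      mul_le_mul_of_nonneg_left h1 ht0
    linarith
  · -- `p` is strictly heavier than `q` without `e`: raising the own pair of `p` keeps it heavier; bound by `I_w(q)`
    push Not at hc
    have hraise : (prodBernoulli w₁).real Rp ≤ (prodBernoulli w₁).real Rq := by
      have h := lightness_le_of_raise_own_edge w A p o q j hpo hqp 0 1 (by norm_num) (le_of_lt hc)
      exact h
    refine le_trans ?_ (le_max_right _ _)
    rw [aff Rq]
    have hA : (1 - t) * ((prodBernoulli w₀).real Sb + (prodBernoulli w₀).real Sa) ≤
        (1 - t) * (prodBernoulli w₀).real Rq :=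
      mul_le_mul_of_nonneg_left h0 (by linarith)
    have hB : t * ((prodBernoulli w₁).real Sb + (prodBernoulli w₁).real Sa) ≤ t * (prodBernoulli w₁).real Rq :=
      mul_le_mul_of_nonneg_left (h1.trans hraise) ht0
    linarith

/-- **The port step against a finite comparison set.**  Let `o ∈ O`, `p ≠ o`, `Q` a nonempty finite set of vertices not
containing `p` (e.g. the remaining ports), `e = s(p,o)`.  If, with `e` deleted, the E-mass of `p` is at most `max_{q ∈ Q} I(q)`, then
under `w` it is at most `max(I_w(p), max_{q ∈ Q} I_w(q))`.  (Apply `obsE_le_max_of_erase` with a maximiser `q ∈ Q`.) [this work] -/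
theorem obsE_le_max_sup_of_erase (w : Sym2 (Fin n) → unitInterval) (A O Q : Finset (Fin n)) (o p : Fin n) (j : ℕ)
    (ho : o ∈ O) (hpo : p ≠ o) (hQ : Q.Nonempty) (hpQ : p ∉ Q)
    (h0 : (prodBernoulli (Function.update w s(p, o) 0)).real {ω : BondConfig (Fin n) | (∀ x ∈ O, ω ∉ openConn p x) ∧
          1 ≤ (A.filter fun z => ∃ x ∈ O, ω ∈ openConn x z).card ∧
          (A.filter fun z => ∃ x ∈ O, ω ∈ openConn x z).card ≤ j} +
        (prodBernoulli (Function.update w s(p, o) 0)).real {ω : BondConfig (Fin n) | (∃ x ∈ O, ω ∈ openConn p x) ∧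
          (A.filter fun z => ω ∈ openConn p z).card ≤ j} ≤
        Q.sup' hQ (fun q => (prodBernoulli (Function.update w s(p, o) 0)).real
          {ω : BondConfig (Fin n) | (A.filter fun z => ω ∈ openConn q z).card ≤ j})) :
    (prodBernoulli w).real {ω : BondConfig (Fin n) | (∀ x ∈ O, ω ∉ openConn p x) ∧
        1 ≤ (A.filter fun z => ∃ x ∈ O, ω ∈ openConn x z).card ∧
        (A.filter fun z => ∃ x ∈ O, ω ∈ openConn x z).card ≤ j} +
      (prodBernoulli w).real {ω : BondConfig (Fin n) | (∃ x ∈ O, ω ∈ openConn p x) ∧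
        (A.filter fun z => ω ∈ openConn p z).card ≤ j} ≤
      max ((prodBernoulli w).real {ω : BondConfig (Fin n) | (A.filter fun z => ω ∈ openConn p z).card ≤ j})
        (Q.sup' hQ (fun q => (prodBernoulli w).real {ω : BondConfig (Fin n) | (A.filter fun z => ω ∈ openConn q z).card ≤ j})) := by
  obtain ⟨q, hq, hqmax⟩ := Finset.exists_mem_eq_sup' hQ
    (fun q => (prodBernoulli (Function.update w s(p, o) 0)).real
      {ω : BondConfig (Fin n) | (A.filter fun z => ω ∈ openConn q z).card ≤ j})
  have hqp : q ≠ p := fun h => hpQ (h ▸ hq)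
  rw [hqmax] at h0
  have h := obsE_le_max_of_erase w A O o p q j ho hpo hqp h0
  refine h.trans (max_le_max le_rfl ?_)
  exact Finset.le_sup' (fun q => (prodBernoulli w).real
    {ω : BondConfig (Fin n) | (A.filter fun z => ω ∈ openConn q z).card ≤ j}) hq

/-- **Common-witness step (deletion–contraction).**  Let `e` be any pair, `c` any vertex, `p` any vertex.  If the E-mass of `c` is at
most `I(p)` both with `e` deleted (`w[e ↦ 0]`) and with `e` glued (`w[e ↦ 1]`), then it is at most `I_w(p)` under `w` (every probability is
affine in `w e`, `HullPort.real_update_affine`).  WHY (crux notes HULLPORT-REF-gen5.md §3c): for an OUTSIDER `c` of the two-pendant-stars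
kernel this is the step "(DC) for `H − e` and for `H/e` with a COMMON witness port `p` ⇒ (DC) for `H`"; exact census: for a relay outside the
ports, 99.9 % of the star edges `e` admit such a common port and every one of 3 200 instances has at least one (seat numerics), whereas the
analogous common-witness property for champion/designation inductions fails (ttrl `mlna`/COUSIN2).  Together with `obsE_le_max_of_erase`
(ports) this is the whole inductive skeleton for (DC). [folklore] -/
theorem obsE_le_of_common_witness (w : Sym2 (Fin n) → unitInterval) (A O : Finset (Fin n)) (e : Sym2 (Fin n)) (c p : Fin n)
    (j : ℕ)
    (h0 : (prodBernoulli (Function.update w e 0)).real {ω : BondConfig (Fin n) | (∀ x ∈ O, ω ∉ openConn c x) ∧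
          1 ≤ (A.filter fun z => ∃ x ∈ O, ω ∈ openConn x z).card ∧
          (A.filter fun z => ∃ x ∈ O, ω ∈ openConn x z).card ≤ j} +
        (prodBernoulli (Function.update w e 0)).real {ω : BondConfig (Fin n) | (∃ x ∈ O, ω ∈ openConn c x) ∧
          (A.filter fun z => ω ∈ openConn c z).card ≤ j} ≤
        (prodBernoulli (Function.update w e 0)).real
          {ω : BondConfig (Fin n) | (A.filter fun z => ω ∈ openConn p z).card ≤ j})
    (h1 : (prodBernoulli (Function.update w e 1)).real {ω : BondConfig (Fin n) | (∀ x ∈ O, ω ∉ openConn c x) ∧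
          1 ≤ (A.filter fun z => ∃ x ∈ O, ω ∈ openConn x z).card ∧
          (A.filter fun z => ∃ x ∈ O, ω ∈ openConn x z).card ≤ j} +
        (prodBernoulli (Function.update w e 1)).real {ω : BondConfig (Fin n) | (∃ x ∈ O, ω ∈ openConn c x) ∧
          (A.filter fun z => ω ∈ openConn c z).card ≤ j} ≤
        (prodBernoulli (Function.update w e 1)).real
          {ω : BondConfig (Fin n) | (A.filter fun z => ω ∈ openConn p z).card ≤ j}) :
    (prodBernoulli w).real {ω : BondConfig (Fin n) | (∀ x ∈ O, ω ∉ openConn c x) ∧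
        1 ≤ (A.filter fun z => ∃ x ∈ O, ω ∈ openConn x z).card ∧
        (A.filter fun z => ∃ x ∈ O, ω ∈ openConn x z).card ≤ j} +
      (prodBernoulli w).real {ω : BondConfig (Fin n) | (∃ x ∈ O, ω ∈ openConn c x) ∧
        (A.filter fun z => ω ∈ openConn c z).card ≤ j} ≤
      (prodBernoulli w).real {ω : BondConfig (Fin n) | (A.filter fun z => ω ∈ openConn p z).card ≤ j} := by
  set Sb : Set (BondConfig (Fin n)) := {ω | (∀ x ∈ O, ω ∉ openConn c x) ∧
        1 ≤ (A.filter fun z => ∃ x ∈ O, ω ∈ openConn x z).card ∧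
        (A.filter fun z => ∃ x ∈ O, ω ∈ openConn x z).card ≤ j} with hSb
  set Sa : Set (BondConfig (Fin n)) := {ω | (∃ x ∈ O, ω ∈ openConn c x) ∧
        (A.filter fun z => ω ∈ openConn c z).card ≤ j} with hSa
  set Rp : Set (BondConfig (Fin n)) := {ω | (A.filter fun z => ω ∈ openConn p z).card ≤ j} with hRp
  set t : ℝ := (w e : ℝ) with ht
  have ht0 : 0 ≤ t := (w e).2.1
  have ht1 : t ≤ 1 := (w e).2.2
  have hwe : Function.update w e (w e) = w := Function.update_eq_self e w
  have aff : ∀ S : Set (BondConfig (Fin n)),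
      (prodBernoulli w).real S = (1 - t) * (prodBernoulli (Function.update w e 0)).real S +
        t * (prodBernoulli (Function.update w e 1)).real S := by
    intro S
    have h := real_update_affine w e (w e) S
    rw [hwe] at h
    exact h
  rw [aff Sb, aff Sa, aff Rp]
  have hA : (1 - t) * ((prodBernoulli (Function.update w e 0)).real Sb + (prodBernoulli (Function.update w e 0)).real Sa) ≤
      (1 - t) * (prodBernoulli (Function.update w e 0)).real Rp :=
    mul_le_mul_of_nonneg_left h0 (by linarith)
  have hB : t * ((prodBernoulli (Function.update w e 1)).real Sb + (prodBernoulli (Function.update w e 1)).real Sa) ≤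
      t * (prodBernoulli (Function.update w e 1)).real Rp :=
    mul_le_mul_of_nonneg_left h1 ht0
  linarith

/-- Splitting the lightness of `q` along `{q ↔ O}`: `I(q) = μ(q ↔ O, |π(q)| ≤ j) + μ(q ↮ O, |π(q)| ≤ j)`. [folklore] -/
theorem obsE_lightness_split (w : Sym2 (Fin n) → unitInterval) (A O : Finset (Fin n)) (q : Fin n) (j : ℕ) :
    (prodBernoulli w).real {ω : BondConfig (Fin n) | (A.filter fun z => ω ∈ openConn q z).card ≤ j} =
      (prodBernoulli w).real {ω : BondConfig (Fin n) | (∃ x ∈ O, ω ∈ openConn q x) ∧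
          (A.filter fun z => ω ∈ openConn q z).card ≤ j} +
        (prodBernoulli w).real {ω : BondConfig (Fin n) | (∀ x ∈ O, ω ∉ openConn q x) ∧
          (A.filter fun z => ω ∈ openConn q z).card ≤ j} := by
  set Rq : Set (BondConfig (Fin n)) := {ω | (A.filter fun z => ω ∈ openConn q z).card ≤ j} with hRq
  set D : Set (BondConfig (Fin n)) := {ω | ∃ x ∈ O, ω ∈ openConn q x} with hD
  have hmeas : MeasurableSet D := (Set.toFinite D).measurableSet
  have h := measureReal_inter_add_sdiff (μ := prodBernoulli w) (s := Rq) hmeas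
  have e1 : Rq ∩ D = {ω : BondConfig (Fin n) | (∃ x ∈ O, ω ∈ openConn q x) ∧
      (A.filter fun z => ω ∈ openConn q z).card ≤ j} := by
    ext ω; simp only [hRq, hD, mem_inter_iff, mem_setOf_eq]; tauto
  have e2 : Rq \ D = {ω : BondConfig (Fin n) | (∀ x ∈ O, ω ∉ openConn q x) ∧
      (A.filter fun z => ω ∈ openConn q z).card ≤ j} := by
    ext ω
    simp only [hRq, hD, mem_sdiff, mem_setOf_eq, not_exists, not_and]
    tauto
  rw [e1, e2] at h
  linarith

/-- **E-mass versus champion stability.**  For any finite observer set `O` and any vertex `q`: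
`I(q) = μ(q ↔ O, |π(q)| ≤ j) + μ(q ↮ O, |π(q)| ≤ j)`, hence the E-mass bound `μ(q ↮ O, 1 ≤ |π(O)| ≤ j) + μ(q ↔ O, |π(q)| ≤ j) ≤ I(q)`
is EQUIVALENT to the champion-stability inequality `CS(O, q)`: `μ(q ↮ O, 1 ≤ |π(O)| ≤ j) ≤ μ(q ↮ O, |π(q)| ≤ j)` (the shape of
`Literature.….observerSet_le_of_lonelier` and of the two-pendant-stars kernel `cil_twoPendantStars_of_TPS`).  This direction: E-bound ⇒ CS.
[folklore] -/
theorem setCS_of_obsE_le (w : Sym2 (Fin n) → unitInterval) (A O : Finset (Fin n)) (q : Fin n) (j : ℕ)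
    (h : (prodBernoulli w).real {ω : BondConfig (Fin n) | (∀ x ∈ O, ω ∉ openConn q x) ∧
          1 ≤ (A.filter fun z => ∃ x ∈ O, ω ∈ openConn x z).card ∧
          (A.filter fun z => ∃ x ∈ O, ω ∈ openConn x z).card ≤ j} +
        (prodBernoulli w).real {ω : BondConfig (Fin n) | (∃ x ∈ O, ω ∈ openConn q x) ∧
          (A.filter fun z => ω ∈ openConn q z).card ≤ j} ≤
        (prodBernoulli w).real {ω : BondConfig (Fin n) | (A.filter fun z => ω ∈ openConn q z).card ≤ j}) :
    (prodBernoulli w).real {ω : BondConfig (Fin n) | (∀ x ∈ O, ω ∉ openConn q x) ∧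
        1 ≤ (A.filter fun z => ∃ x ∈ O, ω ∈ openConn x z).card ∧
        (A.filter fun z => ∃ x ∈ O, ω ∈ openConn x z).card ≤ j} ≤
      (prodBernoulli w).real {ω : BondConfig (Fin n) | (∀ x ∈ O, ω ∉ openConn q x) ∧
        (A.filter fun z => ω ∈ openConn q z).card ≤ j} := by
  have hsplit := obsE_lightness_split w A O q j
  linarith

/-- **Champion stability ⇒ E-mass bound** (converse of `setCS_of_obsE_le`). [folklore] -/
theorem obsE_le_of_setCS (w : Sym2 (Fin n) → unitInterval) (A O : Finset (Fin n)) (q : Fin n) (j : ℕ)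
    (h : (prodBernoulli w).real {ω : BondConfig (Fin n) | (∀ x ∈ O, ω ∉ openConn q x) ∧
        1 ≤ (A.filter fun z => ∃ x ∈ O, ω ∈ openConn x z).card ∧
        (A.filter fun z => ∃ x ∈ O, ω ∈ openConn x z).card ≤ j} ≤
      (prodBernoulli w).real {ω : BondConfig (Fin n) | (∀ x ∈ O, ω ∉ openConn q x) ∧
        (A.filter fun z => ω ∈ openConn q z).card ≤ j}) :
    (prodBernoulli w).real {ω : BondConfig (Fin n) | (∀ x ∈ O, ω ∉ openConn q x) ∧
          1 ≤ (A.filter fun z => ∃ x ∈ O, ω ∈ openConn x z).card ∧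
          (A.filter fun z => ∃ x ∈ O, ω ∈ openConn x z).card ≤ j} +
        (prodBernoulli w).real {ω : BondConfig (Fin n) | (∃ x ∈ O, ω ∈ openConn q x) ∧
          (A.filter fun z => ω ∈ openConn q z).card ≤ j} ≤
        (prodBernoulli w).real {ω : BondConfig (Fin n) | (A.filter fun z => ω ∈ openConn q z).card ≤ j} := by
  have hsplit := obsE_lightness_split w A O q j
  linarith

/-- **Monotone-edge case of the common-witness step.**  If the E-mass of `c` does not decrease when the pair `e` is raised from
deleted to glued (`E_{w[e↦0]}(c) ≤ E_{w[e↦1]}(c)`), then any witness `p` for the GLUED minor (`E_{w[e↦1]}(c) ≤ I_{w[e↦1]}(p)`) is a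
common witness, and `E_w(c) ≤ I_w(p)`: lightness is antitone in the weight (`AveragedPort.lightness_one_le_zero`), so `E_{w[e↦0]}(c) ≤ E_{w[e↦1]}(c) ≤ I_{w[e↦1]}(p) ≤ I_{w[e↦0]}(p)`.
So in the inductive skeleton for (DC) (crux notes HULLPORT-REF-gen5.md §8) only the edges along which the E-mass strictly DECREASES need an
argument (numerically 70–78 % of edges, ≈ 45 % of instances have all edges decreasing). [folklore] -/
theorem obsE_le_of_monotone_edge (w : Sym2 (Fin n) → unitInterval) (A O : Finset (Fin n)) (e : Sym2 (Fin n)) (c p : Fin n)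
    (j : ℕ)
    (hmono : (prodBernoulli (Function.update w e 0)).real {ω : BondConfig (Fin n) | (∀ x ∈ O, ω ∉ openConn c x) ∧
          1 ≤ (A.filter fun z => ∃ x ∈ O, ω ∈ openConn x z).card ∧
          (A.filter fun z => ∃ x ∈ O, ω ∈ openConn x z).card ≤ j} +
        (prodBernoulli (Function.update w e 0)).real {ω : BondConfig (Fin n) | (∃ x ∈ O, ω ∈ openConn c x) ∧
          (A.filter fun z => ω ∈ openConn c z).card ≤ j} ≤
      (prodBernoulli (Function.update w e 1)).real {ω : BondConfig (Fin n) | (∀ x ∈ O, ω ∉ openConn c x) ∧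
          1 ≤ (A.filter fun z => ∃ x ∈ O, ω ∈ openConn x z).card ∧
          (A.filter fun z => ∃ x ∈ O, ω ∈ openConn x z).card ≤ j} +
        (prodBernoulli (Function.update w e 1)).real {ω : BondConfig (Fin n) | (∃ x ∈ O, ω ∈ openConn c x) ∧
          (A.filter fun z => ω ∈ openConn c z).card ≤ j})
    (h1 : (prodBernoulli (Function.update w e 1)).real {ω : BondConfig (Fin n) | (∀ x ∈ O, ω ∉ openConn c x) ∧
          1 ≤ (A.filter fun z => ∃ x ∈ O, ω ∈ openConn x z).card ∧
          (A.filter fun z => ∃ x ∈ O, ω ∈ openConn x z).card ≤ j} +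
        (prodBernoulli (Function.update w e 1)).real {ω : BondConfig (Fin n) | (∃ x ∈ O, ω ∈ openConn c x) ∧
          (A.filter fun z => ω ∈ openConn c z).card ≤ j} ≤
        (prodBernoulli (Function.update w e 1)).real
          {ω : BondConfig (Fin n) | (A.filter fun z => ω ∈ openConn p z).card ≤ j}) :
    (prodBernoulli w).real {ω : BondConfig (Fin n) | (∀ x ∈ O, ω ∉ openConn c x) ∧
        1 ≤ (A.filter fun z => ∃ x ∈ O, ω ∈ openConn x z).card ∧
        (A.filter fun z => ∃ x ∈ O, ω ∈ openConn x z).card ≤ j} +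
      (prodBernoulli w).real {ω : BondConfig (Fin n) | (∃ x ∈ O, ω ∈ openConn c x) ∧
        (A.filter fun z => ω ∈ openConn c z).card ≤ j} ≤
      (prodBernoulli w).real {ω : BondConfig (Fin n) | (A.filter fun z => ω ∈ openConn p z).card ≤ j} := by
  have hanti := AveragedPort.lightness_one_le_zero w A e p j
  exact obsE_le_of_common_witness w A O e c p j (by linarith) h1

end HullPort

end Summit.CriticalPhenomena.PercolationContinuityZ3.Theorems

end
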